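import Mathlib
import Literature.MathematicalPhysics.QuantumFieldTheory.Balaban1983to89.B13MayerDecoupling
import Literature.MathematicalPhysics.QuantumFieldTheory.Balaban1983to89.B13GaugeDevices

/-!
# `Balaban1983to89.B13Sect2Statements` — T. Bałaban, *Renormalization group approach to lattice gauge field theories.
II. Cluster expansions*, Commun. Math. Phys. **116** (1988) 1–22 [Balaban1988RG2Cluster]: Sect. 2 printed OBJECTS
(2.6) (the function `G` and the measure `dμ₀`) and the polymer-expansion identity (2.11), typed and PROVED

statement-level skeleton of published theorems with citation tags; proofs where landed; nothing here is a claim about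
the Yang–Mills mass gap

PDF held: `paper:balaban1988-cmp116-rg-ii-cluster` (journal page = PDF page + 0); quotations read as images from
`run/shared/lean/pub/pub-balaban/b2b-balaban-ref1/pages/1988-cmp116-rg-II-cluster/1988-cmp116-rg-II-cluster-p012-x2.png`,
`…-p013-x2.png`, `…-p014-x2.png`.

CITATION HEADER / WHAT IS REPRODUCED (unit `lit-balaban-r10`; SKELETON rows `B13.Def2.6` (PHASE2-TARGETS.md §C, typing
owner r10) and `B13.Eq2.11` of `HOME/lit-balaban-r10/ROWS-B13.md`):
* **(2.6) pp. 12–13**, verbatim: *"In the integral with respect to B′ we make the linear change of variables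
  B′ = (C^{(k)})^{1/2}X. This yields ∫dμ_{C^{(k)}}(B)F(Z₀, B) = Π_{b∈T₁^{(k)*}} ∫ dX(b)e^{−1/2|X(b)|²}/(2π)^{1/2d(𝔤)}
  · exp(−½⟨C\*Δ_kCZ₀ᶜ(C^{(k)})^{1/2}X, C^{(k)}(Z₀)C\*Δ_kCZ₀ᶜ(C^{(k)})^{1/2}X⟩) · ∫dμ_{C^{(k)}(Z₀)}(B)
  exp(−⟨B, C\*Δ_kCZ₀ᶜ(C^{(k)})^{1/2}X⟩)F(Z₀, B) = ∫dμ₀(X)G(Z₀, X, C^{(k)}(Z₀), (C^{(k)})^{1/2}, Δ_k), (2.6) where the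
  last equality is a definition of the function G, and the measure dμ₀."*  Typed over the FINITE-DIMENSIONAL
  CONDITIONING MODEL of `B13GaugeDevices` §H (DIVERGENCE D-b13.29 there: interior field `x : Λ → ℝ` = `Z₀B`, exterior
  `y : C → ℝ` = `Z₀ᶜB′`, `C*Δ_kC` = the real block matrix `(A, B; Bᵀ, D)`, `C^{(k)}(Z₀) = A⁻¹`, normalised Gaussian
  means `gaussMean`, `dμ₀ = gaussMean 1`), with the white noise `X` and the field `B′` on the WHOLE bond set `Λ ⊕ C`
  and `(C^{(k)})^{1/2}` an arbitrary matrix `T` with `Tᵀ(C*Δ_kC)T = 1`: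
  - `gaussNorm_one`, `mu0_density` — the printed density of `dμ₀`: `∫dμ₀(X)Ψ(X) = (2π)^{−N/2}∫dX e^{−½|X|²}Ψ(X)`,
    `N` = the number of real coordinates (print: `d(𝔤)` per bond), PROVED (`integral_gaussian` coordinatewise);
  - `gamma26` — the source `Z₀C*Δ_kCZ₀ᶜ(C^{(k)})^{1/2}X = B·(Z₀ᶜ TX)` (the `Γ_k X` of (2.14) p. 15 at `s = 1`);
  - `G26` — THE FUNCTION `G` of (2.6) as a named object; `integrand25` — the last underintegral expression of (2.5) as a
    function of the full exterior field `B′`; `G26_eq : G(X) = integrand25(TX)` (`rfl`);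
  - `display_26` — (2.6) itself: `∫dμ_{C^{(k)}}(B′)[integrand25](B′) = ∫dμ₀(X)G(X)`, PROVED (= the whitening
    `B13GaugeDevices.gaussMean_whiten`; the Jacobian cancels against the normalisation).  Together with
    `B13GaugeDevices.display_25` ((2.5), both equalities) this is the whole passage (2.5)–(2.6) in the model.
* **(2.11) p. 14**, verbatim: *"Thus finally we obtain the polymer expansion (2.1) = Σ_{{Z₁,…,Z_n}} H(Z₁)⋯H(Z_n)
  = 1 + Σ_{n=1}^∞ (1/n!) Σ_{(Z₁,…,Z_n)} Π_{{i,j},i<j} ζ(Z_i, Z_j)H(Z₁)⋯H(Z_n), (2.11) where the function ζ(Z, Z′) is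
  defined by the condition: ζ(Z, Z′) = 0 if Z∩Z′ contains a cube, or a wall of a cube, and ζ(Z, Z′) = 1 otherwise."*
  Typed over an abstract finite polymer catalogue `P` (the `Fintype` of `B13MayerDecoupling.ursellSeries212`) with a
  two-body function `ζ : P → P → ℝ`: `hardCore` (the printed `Π_{i<j} ζ`, over `B13MayerDecoupling.lines`),
  `Compatible` (a family `{Z₁,…,Z_n}` of the first sum: distinct polymers with pairwise `ζ = 1` — by (2.9)–(2.10) the
  families are the sets of connected components of a domain `Z`, which pairwise share no cube and no wall),
  `compatibleFamilySum` (the first sum, the empty family giving the printed `1`), `seqTerm` / `polymerSeries211` (the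
  second form, a series in `n` written as a `tsum` whose `n = 0` term is the printed `1`), and the SECOND EQUALITY of
  (2.11) PROVED: `polymerExpansion_211`, under the three properties of the printed `ζ` — values in `{0, 1}`, symmetry,
  and `ζ(Z, Z) = 0` (every polymer contains a cube) — by the bookkeeping the print leaves to the reader (sequences
  with a repeated entry carry a factor `ζ(Z, Z) = 0`, `hardCore_eq_zero_of_not_injective`; an injective sequence
  carries the indicator of the compatibility of its range, `hardCore_of_injective`; each `n`-element family is the
  range of exactly `n!` sequences, `card_injective_seq` / `sum_injective_seq`; the series terminates at `n = |P|`,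
  `seqTerm_eq_zero_of_card_lt`).  The first equality of (2.11) is (2.9)–(2.10) (`B13Factor210`, rows B13.Eq2.9–2.10)
  and is not restated; the exponentiation (2.12) is `B13MayerDecoupling.ursellSeries212` (printed form) /
  `B13Resummation` (Kotecký–Preiss form).
D-0026: no named fact is introduced — every `Prop` here is a proved `theorem`; the `def`s are the printed objects.
HOME: `run/shared/lean/pub/lit-balaban/` (ROWS-B13.md rows B13.Def2.6, B13.Eq2.11; PHASE2-TARGETS.md §C).

v4 (unit `lit-balaban-r10` gen 2, 2026-08-21; APPEND-ONLY, ruling G.5-3 of `HOME/PHASE2-TARGETS.md` = referee ref-1's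
ACK erratum on SKELETON row `B13.Eq2.8`: *"no decl carries the locator (2.8) p.14"*).  Part C adds the display
* **(2.8) p. 14**, verbatim (render `…-p014-x2.png`, first display; the lead-in is the last line of p. 13, *"Using
  these expansions we introduce the parameters s, and we apply the* [p. 14] *decomposition (1.10),"*):
  `∫dμ₀(X)G(Z₀, X, C^{(k)}(Z₀), (C^{(k)})^{1/2}, Δ_k) = Σ_Z Π_{Δ⊂Z∖Z̃′₀} ∫₀¹ ds(Δ) ∂/∂s(Δ)
     · ∫dμ₀(X)G(Z₀, X, C^{(k)}(Z₀, s(Z)), (C^{(k)})^{1/2}(s(Z)), Δ_k(s(Z))) = Σ_Z H(Z, Z₀).`  (2.8)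
  *"The sums are over Z such, that each connected component of Z contains a component of Z′₀."*  — as the NAMED
  INSTANCE of the decoupling identity (1.9) (`B13MayerDecoupling.decoupling_19`, `decoupling_19_integral`) it is:
  parameter cubes `σ₀` = the LM-cubes of p. 13 (*"We define σ₀ as the family of such cubes Δ disjoint with the
  interior of Z̃₀, or with the interior of Z′₀"*), domains `Z = Z′₀ ∪ σ`, `σ ⊆ σ₀` (`domains28`; the printed index set
  `Δ ⊂ Z∖Z̃′₀` is read `Z∖Z′₀`, the cell's recorded reading of the diacritic, cf. `B13Factor210Literal` header), the
  σ-term evaluated at `s(σ₀∖σ) = 0`, and the function of the parameters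
  `Φ(s) = ∫dμ₀(X)G(Z₀, X, C^{(k)}(Z₀, s), (C^{(k)})^{1/2}(s), Δ_k(s))` ARBITRARY: `display_28` (difference-operator
  form, every `Φ`), `display_28_integral` (the printed `Π∫₀¹ds(Δ)∂/∂s(Δ)` for `Φ` with continuous mixed partials along
  the parameter axes, `HasLinePartials`), `H28` (the summand `H(Z, Z₀)` as a named object, second equality of (2.8) by
  `rfl`: `display_28_H`), and `display_28_restricted` (the printed range restriction, GIVEN the vanishing of the other
  terms — the mechanism (1.10), `B13MayerDecoupling.Dop_eq_zero_of_indep`, whose hypothesis for the paper's `Φ` is the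
  by-reference random-walk locality of Sect. 1 and is NOT decided here).  The admissibility algebra of the range
  condition is the existing `B13Factor210Literal.AdmLit` / `B13Factor210.admMeets` (rows B13.Eq2.9–2.10); nothing of
  it is duplicated.  No named fact introduced (D-0026).
-/

noncomputable section

namespace Literature.MathematicalPhysics.QuantumFieldTheory.Balaban1983to89.B13Sect2Statements

open Matrix MeasureTheory Finset
open Literature.MathematicalPhysics.QuantumFieldTheory.Balaban1983to89.B13GaugeDevices
open Literature.MathematicalPhysics.QuantumFieldTheory.Balaban1983to89.B13MayerDecoupling

/-! ## Part A. (2.6) pp. 12–13: the measure `dμ₀` and the function `G` -/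

section Display26

variable {Λ C : Type} [Fintype Λ] [Fintype C] [DecidableEq Λ] [DecidableEq C]
variable {E : Type*} [NormedAddCommGroup E] [NormedSpace ℝ E]

/-- **The normalisation of `dμ₀`** ((2.6) p. 12, the factor *"(2π)^{1/2 d(𝔤)}"* per bond): in the model
(`B13GaugeDevices.gaussNorm`, Lebesgue `dX` on the real coordinates `Λ`), `∫dX e^{−½|X|²} = (2π)^{N/2}`,
`N = |Λ|` (print: `N = d(𝔤)·|T₁^{(k)*}|`). [cite: Balaban1988RG2Cluster, (2.6) p.12] -/
theorem gaussNorm_one : gaussNorm (1 : Matrix Λ Λ ℝ) = (√(2 * Real.pi)) ^ Fintype.card Λ := by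
  unfold gaussNorm gaussWeight
  have h : ∀ x : Λ → ℝ, Real.exp (-(1 / 2 * (x ⬝ᵥ ((1 : Matrix Λ Λ ℝ) *ᵥ x))))
      = ∏ i, Real.exp (-(1 / 2) * (x i) ^ 2) := by
    intro x
    rw [one_mulVec, ← Real.exp_sum]
    congr 1
    simp only [dotProduct, Finset.mul_sum, ← Finset.sum_neg_distrib]
    refine Finset.sum_congr rfl fun i _ => by ring
  simp_rw [h]
  rw [integral_fintype_prod_volume_eq_pow (fun t : ℝ => Real.exp (-(1 / 2) * t ^ 2)), integral_gaussian]
  congr 1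
  congr 1
  ring

/-- **`dμ₀` as printed** ((2.6) p. 12): *"Π_{b∈T₁^{(k)*}} ∫ dX(b) e^{−1/2|X(b)|²}/(2π)^{1/2 d(𝔤)}"* — the model's
`∫dμ₀(X)Ψ(X) := gaussMean 1 Ψ` IS the normalised standard Gaussian integral
`(2π)^{−N/2} ∫dX e^{−½Σ_i X_i²} Ψ(X)` over the real coordinates `X_i`, `i ∈ Λ` (`= (b, a)`, `a ≤ d(𝔤)`).
[cite: Balaban1988RG2Cluster, (2.6) p.12] -/
theorem mu0_density (Ψ : (Λ → ℝ) → E) :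
    gaussMean (1 : Matrix Λ Λ ℝ) Ψ
      = ((√(2 * Real.pi)) ^ Fintype.card Λ)⁻¹ • ∫ X : Λ → ℝ, Real.exp (-(1 / 2 * ∑ i, X i ^ 2)) • Ψ X := by
  rw [gaussMean, gaussNorm_one, gaussInt]
  congr 1
  refine integral_congr_ae (Filter.Eventually.of_forall fun X => ?_)
  simp only [gaussWeight, one_mulVec, dotProduct, pow_two]

/-- The source seen by the interior field in (2.5)–(2.6): `Γ X := Z₀C*Δ_kCZ₀ᶜ(C^{(k)})^{1/2}X` — in the block model
`B·(Z₀ᶜ-part of TX)` with `B = Z₀C*Δ_kCZ₀ᶜ` the off-diagonal block and `T = (C^{(k)})^{1/2}` on the whole bond set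
`Λ ⊕ C` (this is the operator `Γ_k(Z₀, σ)` of (2.14) p. 15 at `σ = 1`). [cite: Balaban1988RG2Cluster, (2.6) p.13] -/
def gamma26 (B : Matrix Λ C ℝ) (T : Matrix (Λ ⊕ C) (Λ ⊕ C) ℝ) (X : Λ ⊕ C → ℝ) : Λ → ℝ :=
  B *ᵥ fun c => (T *ᵥ X) (Sum.inr c)

/-- **The function `G` of (2.6)** p. 13 (*"where the last equality is a definition of the function G"*), in the
block model, as a function of the white noise `X` on the whole bond set, for given data `F = F(Z₀, ·)` (a function of
the interior field `B = Z₀B`), `A` (`A⁻¹ = C^{(k)}(Z₀)`), `B` (the block `Z₀C*Δ_kCZ₀ᶜ` of `C*Δ_kC` — the only part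
of `Δ_k` that enters) and `T = (C^{(k)})^{1/2}`:
`G(Z₀, X, C^{(k)}(Z₀), (C^{(k)})^{1/2}, Δ_k) := exp(−½⟨ΓX, C^{(k)}(Z₀)ΓX⟩) · ∫dμ_{C^{(k)}(Z₀)}(B) e^{−⟨B, ΓX⟩} F(Z₀, B)`,
`ΓX = gamma26 B T X`.  The three operator arguments are kept separate, as printed, because (2.8) p. 14 gives them
independent `s`-dependences. [cite: Balaban1988RG2Cluster, (2.6) p.13] -/
def G26 (F : (Λ → ℝ) → E) (A : Matrix Λ Λ ℝ) (B : Matrix Λ C ℝ) (T : Matrix (Λ ⊕ C) (Λ ⊕ C) ℝ)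
    (X : Λ ⊕ C → ℝ) : E :=
  Real.exp (-(1 / 2 * (gamma26 B T X ⬝ᵥ (A⁻¹ *ᵥ gamma26 B T X))))
    • gaussMean A (fun x => Real.exp (-(gamma26 B T X ⬝ᵥ x)) • F x)

/-- The last underintegral expression of (2.5) p. 12 as a function of the FULL exterior field `B′` on `Λ ⊕ C` (it
depends on `Z₀ᶜB′ = (B′ ∘ inr)` only): `exp(−½⟨Z₀ᶜB′, C\*Δ_kC C^{(k)}(Z₀) C\*Δ_kC Z₀ᶜB′⟩) · ∫dμ_{C^{(k)}(Z₀)}(B)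
exp(−⟨Z₀ᶜB′, C\*Δ_kCZ₀B⟩)F(Z₀, B)` — exactly the right-hand side of `B13GaugeDevices.ratio_25` at the source
`j = B(Z₀ᶜB′)`. [cite: Balaban1988RG2Cluster, (2.5) p.12] -/
def integrand25 (F : (Λ → ℝ) → E) (A : Matrix Λ Λ ℝ) (B : Matrix Λ C ℝ) (B' : Λ ⊕ C → ℝ) : E :=
  Real.exp (-(1 / 2 * ((B *ᵥ fun c => B' (Sum.inr c)) ⬝ᵥ (A⁻¹ *ᵥ (B *ᵥ fun c => B' (Sum.inr c))))))
    • gaussMean A (fun x => Real.exp (-((B *ᵥ fun c => B' (Sum.inr c)) ⬝ᵥ x)) • F x)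

omit [DecidableEq C] in
/-- `G` IS the (2.5)-integrand after the substitution `B′ = (C^{(k)})^{1/2}X` (by `rfl`): the content of *"This
yields"* in (2.6). [cite: Balaban1988RG2Cluster, (2.6) pp.12–13] -/
theorem G26_eq (F : (Λ → ℝ) → E) (A : Matrix Λ Λ ℝ) (B : Matrix Λ C ℝ) (T : Matrix (Λ ⊕ C) (Λ ⊕ C) ℝ)
    (X : Λ ⊕ C → ℝ) : G26 F A B T X = integrand25 F A B (T *ᵥ X) := rfl

/-- **(2.6)** pp. 12–13 in the block model: for the full precision `C*Δ_kC = (A, B; Bᵀ, D)` and ANY `T` with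
`Tᵀ(C*Δ_kC)T = 1` (print: `T = (C^{(k)})^{1/2} = (C*Δ_kC)^{−1/2}`, (2.7)),
`∫dμ_{C^{(k)}}(B′) [exp(−½⟨…⟩) ∫dμ_{C^{(k)}(Z₀)}(B) e^{−⟨B, …B′⟩} F(Z₀, B)] = ∫dμ₀(X) G(Z₀, X, C^{(k)}(Z₀), (C^{(k)})^{1/2}, Δ_k)`
— PROVED: it is the whitening `B13GaugeDevices.gaussMean_whiten` (the Jacobian `|det T|` cancels against the
normalisation; no hypothesis on `F`).  With `B13GaugeDevices.display_25` ((2.5)) this is the passage (2.5)–(2.6).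
[cite: Balaban1988RG2Cluster, (2.6) pp.12–13] -/
theorem display_26 (F : (Λ → ℝ) → E) (A : Matrix Λ Λ ℝ) (B : Matrix Λ C ℝ) (D : Matrix C C ℝ)
    (T : Matrix (Λ ⊕ C) (Λ ⊕ C) ℝ) (hT : Tᵀ * Matrix.fromBlocks A B Bᵀ D * T = 1) :
    gaussMean (Matrix.fromBlocks A B Bᵀ D) (integrand25 F A B)
      = gaussMean (1 : Matrix (Λ ⊕ C) (Λ ⊕ C) ℝ) (G26 F A B T) :=
  (gaussMean_whiten (Matrix.fromBlocks A B Bᵀ D) T hT (integrand25 F A B)).symm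

end Display26

/-! ## Part B. (2.11) p. 14: the polymer expansion — families of compatible polymers versus sequences with the hard
core `Π_{i<j} ζ(Z_i, Z_j)` and the factor `1/n!` -/

section Polymer211

section HardCore

variable {P : Type*}

/-- The printed hard-core factor of a sequence `(Z₁,…,Z_n)`: *"Π_{{i,j},i<j} ζ(Z_i, Z_j)"* ((2.11) p. 14), the
lines `{i, j}`, `i < j`, being `B13MayerDecoupling.lines n`.
  Existing carriers citing (2.11): the SET form `Literature.Probability.LatticeModels.polymerPartitionFunction` (used via
`B13Resummation.Geometry`), the abstract resummation `B13Factor210.Hsum` / `B13Factor210Literal.HsumLit` ((2.9)–(2.11) first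
form), `B13Closing`, `B12StepFromB13` (KP vocabulary); the objects below are the PRINTED sequence/family forms (DUPLICATES rule:
printed form, carriers named).
[cite: Balaban1988RG2Cluster, (2.11) p.14] -/
def hardCore (ζ : P → P → ℝ) {n : ℕ} (Z : Fin n → P) : ℝ := ∏ p ∈ lines n, ζ (Z p.1) (Z p.2)

/-- A family `{Z₁,…,Z_n}` of the first sum in (2.11): a finite set of (distinct) polymers, pairwise compatible,
`ζ(Z, Z′) = 1` for `Z ≠ Z′` in the family — by (2.9)–(2.10) p. 14 these families are the sets of connected
components of the domains `Z`, and two different components share no cube and no wall of a cube.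
[cite: Balaban1988RG2Cluster, (2.11) p.14] -/
def Compatible (ζ : P → P → ℝ) (F : Finset P) : Prop := ∀ Z ∈ F, ∀ Z' ∈ F, Z ≠ Z' → ζ Z Z' = 1

/-- Classical decidability of compatibility (for the finite sums below; plumbing).
[cite: Balaban1988RG2Cluster, (2.11) p.14] (elementary API for (2.11)) -/
instance Compatible.instDecidablePred (ζ : P → P → ℝ) : DecidablePred (Compatible ζ) := Classical.decPred _

/-- A sequence with a repeated entry carries the factor `ζ(Z, Z) = 0` (print: *"ζ(Z, Z′) = 0 if Z∩Z′ contains a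
cube"*, and every polymer contains a cube), so its hard-core factor vanishes: only sequences of DISTINCT polymers
contribute to the second form of (2.11). [cite: Balaban1988RG2Cluster, (2.11) p.14] -/
theorem hardCore_eq_zero_of_not_injective (ζ : P → P → ℝ) (hdiag : ∀ Z, ζ Z Z = 0) {n : ℕ} {Z : Fin n → P}
    (hZ : ¬ Function.Injective Z) : hardCore ζ Z = 0 := by
  unfold hardCore
  obtain ⟨i, j, hij, hne⟩ : ∃ i j, Z i = Z j ∧ i ≠ j := by
    simpa [Function.Injective, not_forall] using hZ
  rcases lt_or_gt_of_ne hne with h | h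
  · exact Finset.prod_eq_zero (i := (i, j)) (by simp [lines, h]) (by simp [hij, hdiag])
  · exact Finset.prod_eq_zero (i := (j, i)) (by simp [lines, h]) (by simp [hij, hdiag])

/-- For a sequence of distinct polymers the hard-core factor is the indicator of the compatibility of the family it
enumerates (`ζ` takes the values `0, 1` and is symmetric, as the printed `ζ` is).
[cite: Balaban1988RG2Cluster, (2.11) p.14] -/
theorem hardCore_of_injective [DecidableEq P] (ζ : P → P → ℝ) (h01 : ∀ Z Z', ζ Z Z' = 0 ∨ ζ Z Z' = 1)
    (hsymm : ∀ Z Z', ζ Z Z' = ζ Z' Z) {n : ℕ} {Z : Fin n → P} (hZ : Function.Injective Z) :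
    hardCore ζ Z = if Compatible ζ (Finset.univ.image Z) then 1 else 0 := by
  unfold hardCore
  split_ifs with hc
  · refine Finset.prod_eq_one fun p hp => ?_
    have hlt : p.1 < p.2 := by simpa [lines] using hp
    exact hc _ (Finset.mem_image_of_mem _ (Finset.mem_univ _)) _ (Finset.mem_image_of_mem _ (Finset.mem_univ _))
      (fun h => (ne_of_lt hlt) (hZ h))
  · simp only [Compatible, not_forall, exists_prop] at hc
    obtain ⟨a, ha, b, hb, hab, hζ⟩ := hc
    obtain ⟨i, -, rfl⟩ := Finset.mem_image.1 ha
    obtain ⟨j, -, rfl⟩ := Finset.mem_image.1 hb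
    have hij : i ≠ j := fun h => hab (by rw [h])
    have h0 : ζ (Z i) (Z j) = 0 := (h01 _ _).resolve_right hζ
    rcases lt_or_gt_of_ne hij with h | h
    · exact Finset.prod_eq_zero (i := (i, j)) (by simp [lines, h]) (by simpa using h0)
    · exact Finset.prod_eq_zero (i := (j, i)) (by simp [lines, h]) (by rw [hsymm]; simpa using h0)

/-- The sequences of distinct polymers taken from a family `F` are the embeddings `Fin n ↪ F` (plumbing).
[cite: Balaban1988RG2Cluster, (2.11) p.14] (elementary API for (2.11)) -/
def seqEquivEmb (F : Finset P) (n : ℕ) :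
    {Z : Fin n → P // Function.Injective Z ∧ ∀ i, Z i ∈ F} ≃ (Fin n ↪ F) where
  toFun Z := ⟨fun i => ⟨Z.1 i, Z.2.2 i⟩, fun _ _ h => Z.2.1 (congrArg Subtype.val h)⟩
  invFun e := ⟨fun i => (e i).1, fun _ _ h => e.injective (Subtype.ext h), fun i => (e i).2⟩
  left_inv _ := rfl
  right_inv _ := rfl

end HardCore

variable {P : Type*} [Fintype P]

/-- The order-`n` term of the second form of (2.11) (before the factor `1/n!`):
`Σ_{(Z₁,…,Z_n)} Π_{{i,j},i<j} ζ(Z_i, Z_j) H(Z₁)⋯H(Z_n)` over ALL sequences of polymers of the (finite) catalogue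
`P`.  (Existing carriers of the locus: see `hardCore`.) [cite: Balaban1988RG2Cluster, (2.11) p.14] -/
def seqTerm (ζ : P → P → ℝ) (H : P → ℂ) (n : ℕ) : ℂ :=
  ∑ Z : Fin n → P, ((hardCore ζ Z : ℝ) : ℂ) * ∏ i, H (Z i)

/-- The second form of (2.11) AS PRINTED: *"1 + Σ_{n=1}^∞ (1/n!) Σ_{(Z₁,…,Z_n)} Π_{{i,j},i<j} ζ(Z_i, Z_j) H(Z₁)⋯H(Z_n)"*,
written as a `tsum` over `n ≥ 0` whose `n = 0` term (one empty sequence, empty products) is the printed `1`; for a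
finite catalogue the series terminates (`seqTerm_eq_zero_of_card_lt`).  (Existing carriers of the locus: see `hardCore`.)
[cite: Balaban1988RG2Cluster, (2.11) p.14] -/
def polymerSeries211 (ζ : P → P → ℝ) (H : P → ℂ) : ℂ := ∑' n : ℕ, ((n.factorial : ℂ)⁻¹ * seqTerm ζ H n)

/-- The first form of (2.11) AS PRINTED: *"Σ_{{Z₁,…,Z_n}} H(Z₁)⋯H(Z_n)"* — the sum over the compatible families of
polymers of the catalogue (the empty family contributing `1`); in SET form this is
`Literature.Probability.LatticeModels.polymerPartitionFunction` (existing carrier; see `hardCore`).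
[cite: Balaban1988RG2Cluster, (2.11) p.14] -/
def compatibleFamilySum (ζ : P → P → ℝ) (H : P → ℂ) : ℂ :=
  ∑ F ∈ (Finset.univ : Finset P).powerset with Compatible ζ F, ∏ Z ∈ F, H Z

/-- Each `n`-element family is enumerated by exactly `n!` sequences of distinct polymers — the origin of the printed
`1/n!`. [cite: Balaban1988RG2Cluster, (2.11) p.14] -/
theorem card_injective_seq [DecidableEq P] (F : Finset P) (n : ℕ) (hF : F.card = n) :
    ((Finset.univ : Finset (Fin n → P)).filter
        (fun Z => Function.Injective Z ∧ Finset.univ.image Z = F)).card = n.factorial := by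
  have hset : ((Finset.univ : Finset (Fin n → P)).filter
      (fun Z => Function.Injective Z ∧ Finset.univ.image Z = F))
      = (Finset.univ : Finset (Fin n → P)).filter (fun Z => Function.Injective Z ∧ ∀ i, Z i ∈ F) := by
    ext Z
    simp only [Finset.mem_filter, Finset.mem_univ, true_and, and_congr_right_iff]
    intro hZ
    constructor
    · intro h i; rw [← h]; exact Finset.mem_image_of_mem _ (Finset.mem_univ _)
    · intro h
      apply Finset.eq_of_subset_of_card_le
      · intro a ha; obtain ⟨i, -, rfl⟩ := Finset.mem_image.1 ha; exact h i
      · rw [hF, Finset.card_image_of_injective _ hZ, Finset.card_univ, Fintype.card_fin]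
  rw [hset, ← Fintype.card_subtype, Fintype.card_congr (seqEquivEmb F n), Fintype.card_embedding_eq,
    Fintype.card_coe, hF, Fintype.card_fin, Nat.descFactorial_self]

/-- Summing a function of the enumerated family over the sequences of distinct polymers of length `n` gives `n!` times
its sum over the `n`-element families. [cite: Balaban1988RG2Cluster, (2.11) p.14] -/
theorem sum_injective_seq [DecidableEq P] (g : Finset P → ℂ) (n : ℕ) :
    ∑ Z ∈ (Finset.univ : Finset (Fin n → P)).filter (fun Z => Function.Injective Z), g (Finset.univ.image Z)
      = (n.factorial : ℂ) * ∑ F ∈ Finset.univ.powersetCard n, g F := by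
  rw [← Finset.sum_fiberwise_of_maps_to (t := Finset.univ.powersetCard n)
    (g := fun Z : Fin n → P => Finset.univ.image Z)
    (fun Z hZ => by
      have hZ' : Function.Injective Z := (Finset.mem_filter.1 hZ).2
      simp [Finset.mem_powersetCard, Finset.card_image_of_injective _ hZ'])]
  rw [Finset.mul_sum]
  refine Finset.sum_congr rfl fun F hF => ?_
  have hFn : F.card = n := (Finset.mem_powersetCard.1 hF).2
  rw [Finset.filter_filter]
  rw [Finset.sum_congr rfl (fun Z hZ => by rw [(Finset.mem_filter.1 hZ).2.2] :
      ∀ Z ∈ (Finset.univ.filter fun Z : Fin n → P => Function.Injective Z ∧ Finset.univ.image Z = F),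
        g (Finset.univ.image Z) = g F)]
  rw [Finset.sum_const, card_injective_seq F n hFn, nsmul_eq_mul]

/-- The order-`n` term of the second form of (2.11) is `n!` times the sum over the compatible `n`-element families.
[cite: Balaban1988RG2Cluster, (2.11) p.14] -/
theorem seqTerm_eq (ζ : P → P → ℝ) (H : P → ℂ) (h01 : ∀ Z Z', ζ Z Z' = 0 ∨ ζ Z Z' = 1)
    (hsymm : ∀ Z Z', ζ Z Z' = ζ Z' Z) (hdiag : ∀ Z, ζ Z Z = 0) (n : ℕ) :
    seqTerm ζ H n = (n.factorial : ℂ) * ∑ F ∈ Finset.univ.powersetCard n with Compatible ζ F, ∏ Z ∈ F, H Z := by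
  classical
  unfold seqTerm
  -- restrict to injective sequences
  rw [← Finset.sum_filter_add_sum_filter_not Finset.univ (fun Z : Fin n → P => Function.Injective Z)]
  rw [Finset.sum_eq_zero (s := Finset.univ.filter fun Z : Fin n → P => ¬ Function.Injective Z)
    (fun Z hZ => by
      rw [hardCore_eq_zero_of_not_injective ζ hdiag (Finset.mem_filter.1 hZ).2]; simp), add_zero]
  -- rewrite the summand through the enumerated family
  set g : Finset P → ℂ := fun F => if Compatible ζ F then ∏ Z' ∈ F, H Z' else 0 with hg
  have key : ∀ Z ∈ (Finset.univ.filter fun Z : Fin n → P => Function.Injective Z),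
      ((hardCore ζ Z : ℝ) : ℂ) * ∏ i, H (Z i) = g (Finset.univ.image Z) := by
    intro Z hZ
    have hZ' : Function.Injective Z := (Finset.mem_filter.1 hZ).2
    rw [hardCore_of_injective ζ h01 hsymm hZ', hg]
    simp only
    split_ifs with hc
    · rw [Finset.prod_image (fun i _ j _ h => hZ' h)]; simp
    · simp
  calc ∑ Z ∈ (Finset.univ.filter fun Z : Fin n → P => Function.Injective Z), ((hardCore ζ Z : ℝ) : ℂ) * ∏ i, H (Z i)
      = ∑ Z ∈ (Finset.univ.filter fun Z : Fin n → P => Function.Injective Z), g (Finset.univ.image Z) :=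
        Finset.sum_congr rfl key
    _ = (n.factorial : ℂ) * ∑ F ∈ Finset.univ.powersetCard n, g F := sum_injective_seq g n
    _ = (n.factorial : ℂ) * ∑ F ∈ Finset.univ.powersetCard n with Compatible ζ F, ∏ Z ∈ F, H Z := by
        rw [hg, Finset.sum_filter]

/-- The series terminates: for `n > |P|` every sequence repeats a polymer. [cite: Balaban1988RG2Cluster, (2.11) p.14] -/
theorem seqTerm_eq_zero_of_card_lt (ζ : P → P → ℝ) (H : P → ℂ) (hdiag : ∀ Z, ζ Z Z = 0) {n : ℕ}
    (hn : Fintype.card P < n) : seqTerm ζ H n = 0 := by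
  unfold seqTerm
  refine Finset.sum_eq_zero fun Z _ => ?_
  have hZ : ¬ Function.Injective Z := fun h => by
    have := Fintype.card_le_of_injective Z h
    simp only [Fintype.card_fin] at this
    omega
  rw [hardCore_eq_zero_of_not_injective ζ hdiag hZ]; simp

/-- **(2.11) p. 14, second equality** — *"Σ_{{Z₁,…,Z_n}} H(Z₁)⋯H(Z_n) = 1 + Σ_{n=1}^∞ (1/n!) Σ_{(Z₁,…,Z_n)}
Π_{{i,j},i<j} ζ(Z_i, Z_j) H(Z₁)⋯H(Z_n)"* — PROVED for every finite polymer catalogue `P`, all activities `H`, and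
every two-body function `ζ` with the three properties of the printed one: values in `{0, 1}`, symmetric, and
`ζ(Z, Z) = 0`. [cite: Balaban1988RG2Cluster, (2.11) p.14] -/
theorem polymerExpansion_211 (ζ : P → P → ℝ) (H : P → ℂ) (h01 : ∀ Z Z', ζ Z Z' = 0 ∨ ζ Z Z' = 1)
    (hsymm : ∀ Z Z', ζ Z Z' = ζ Z' Z) (hdiag : ∀ Z, ζ Z Z = 0) :
    compatibleFamilySum ζ H = polymerSeries211 ζ H := by
  unfold compatibleFamilySum polymerSeries211
  rw [tsum_eq_sum (s := Finset.range (Fintype.card P + 1))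
    (fun n hn => by
      rw [seqTerm_eq_zero_of_card_lt ζ H hdiag (by simpa using hn)]; simp)]
  simp_rw [seqTerm_eq ζ H h01 hsymm hdiag, ← mul_assoc]
  rw [Finset.sum_congr rfl (fun n _ => by
      rw [inv_mul_cancel₀ (by exact_mod_cast n.factorial_ne_zero), one_mul] :
      ∀ n ∈ Finset.range (Fintype.card P + 1),
        (n.factorial : ℂ)⁻¹ * (n.factorial : ℂ) * ∑ F ∈ Finset.univ.powersetCard n with Compatible ζ F, ∏ Z ∈ F, H Z
          = ∑ F ∈ Finset.univ.powersetCard n with Compatible ζ F, ∏ Z ∈ F, H Z)]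
  rw [Finset.powerset_card_disjiUnion, Finset.filter_disjiUnion, Finset.sum_disjiUnion, Finset.card_univ]

end Polymer211

/-! ## Part C (v4, append-only). (2.8) p. 14 — the decoupling expansion (1.9)/(1.10) applied with the LM-cubes `σ₀`
of p. 13: a (2.8)-tagged NAMED INSTANCE of `B13MayerDecoupling.decoupling_19` (ruling G.5-3) -/

section Display28

variable {ι : Type*} [DecidableEq ι]

/-- The domains `Z` of (2.8) p. 14: `Z′₀` with a sub-family `σ ⊆ σ₀` of the LM-cubes of p. 13 adjoined (*"We define
σ₀ as the family of such cubes Δ disjoint with the interior of Z̃₀, or with the interior of Z′₀, where Z′₀ is a union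
of the smallest family of such cubes containing Z̃₀"*), so that `Z∖Z′₀ = σ` is the printed index set of the product
`Π_{Δ⊂Z∖Z̃′₀}` (diacritic read as in the `B13Factor210Literal` header).  Cubes are abstract indices `ι`; `Z′₀` and `σ₀`
are disjoint finite families.  (Related existing carriers of the range condition of (2.8)/(2.9):
`B13Factor210Literal.AdmLit`, `B13Factor210.admMeets`; of the parameter device: `B13GaugeDevices.Inv.paramOp`.)
[cite: Balaban1988RG2Cluster, (2.8) p.14] -/
def domains28 (Z₀' σ₀ : Finset ι) : Finset (Finset ι) := σ₀.powerset.image fun σ => Z₀' ∪ σ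

/-- `Z ↦ Z′₀ ∪ σ` recovers `σ = Z∖Z′₀` when `Z′₀` and `σ₀ ⊇ σ` are disjoint (plumbing).
[cite: Balaban1988RG2Cluster, (2.8) p.14] (elementary API for (2.8)) -/
private theorem union_sdiff_eq_of_disjoint {Z₀' σ₀ σ : Finset ι} (hdisj : Disjoint Z₀' σ₀) (hσ : σ ⊆ σ₀) :
    (Z₀' ∪ σ) \ Z₀' = σ := by
  rw [Finset.union_sdiff_left, Finset.sdiff_eq_self_iff_disjoint]
  exact (hdisj.mono_right hσ).symm

/-- The parametrisation `σ ↦ Z′₀ ∪ σ` of the domains of (2.8) is injective on the sub-families of `σ₀` (plumbing).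
[cite: Balaban1988RG2Cluster, (2.8) p.14] (elementary API for (2.8)) -/
private theorem injOn_union {Z₀' σ₀ : Finset ι} (hdisj : Disjoint Z₀' σ₀) :
    Set.InjOn (fun σ : Finset ι => Z₀' ∪ σ) ↑(σ₀.powerset) := by
  intro σ hσ τ hτ h
  have hσ' : σ ⊆ σ₀ := Finset.mem_powerset.1 (Finset.mem_coe.1 hσ)
  have hτ' : τ ⊆ σ₀ := Finset.mem_powerset.1 (Finset.mem_coe.1 hτ)
  have := congrArg (fun W : Finset ι => W \ Z₀') h
  simpa only [union_sdiff_eq_of_disjoint hdisj hσ', union_sdiff_eq_of_disjoint hdisj hτ'] using this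

section Difference

variable {E : Type*} [AddCommGroup E]

/-- **The summand `H(Z, Z₀)` of (2.8) p. 14 as a named object** (second equality of (2.8), a definition in print):
for a domain `Z ⊇ Z′₀` and the function `Φ(s) = ∫dμ₀(X)G(Z₀, X, C^{(k)}(Z₀, s), (C^{(k)})^{1/2}(s), Δ_k(s))` of the
parameters `s(Δ)`, `H(Z, Z₀) := (Π_{Δ∈Z∖Z′₀} ∫₀¹ ds(Δ) ∂/∂s(Δ)) Φ |_{s(σ₀∖(Z∖Z′₀)) = 0}` — here in difference-operator
form `D_{Z∖Z′₀} Φ` at the corner `s(σ₀) = 0` (`B13MayerDecoupling.Dop`, `corner`; the printed integrals are equal to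
it for regular `Φ`, `B13MayerDecoupling.Top_eq_Dop`).  The dependence on `Z₀` sits in `Φ`, `Z′₀`, `σ₀`.
[cite: Balaban1988RG2Cluster, (2.8) p.14] -/
def H28 (Z₀' σ₀ : Finset ι) (Φ : (ι → ℝ) → E) (s : ι → ℝ) (Z : Finset ι) : E :=
  Dop (Z \ Z₀') Φ (corner σ₀ ∅ s)

/-- **(2.8) p. 14, first equality** — verbatim *"∫dμ₀(X)G(Z₀, X, C^{(k)}(Z₀), (C^{(k)})^{1/2}, Δ_k)
= Σ_Z Π_{Δ⊂Z∖Z̃′₀} ∫₀¹ ds(Δ) ∂/∂s(Δ) · ∫dμ₀(X)G(Z₀, X, C^{(k)}(Z₀, s(Z)), (C^{(k)})^{1/2}(s(Z)), Δ_k(s(Z)))"* — as the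
instance of the decoupling identity (1.9) (`B13MayerDecoupling.decoupling_19`) with parameter cubes `σ₀` = the
LM-cubes of p. 13 and domains `Z = Z′₀ ∪ σ` (`domains28`): for EVERY function `Φ` of the parameters (left side =
`Φ` at `s(σ₀) = 1`, the undecoupled operators, (1.8)), the σ-terms in difference-operator form (`Dop`; printed
integral form: `display_28_integral`), BEFORE the range restriction (`display_28_restricted`).
[cite: Balaban1988RG2Cluster, (2.8) p.14] -/
theorem display_28 (Z₀' σ₀ : Finset ι) (hdisj : Disjoint Z₀' σ₀) (Φ : (ι → ℝ) → E) (s : ι → ℝ) :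
    Φ (corner σ₀ σ₀ s) = ∑ Z ∈ domains28 Z₀' σ₀, Dop (Z \ Z₀') Φ (corner σ₀ ∅ s) := by
  rw [domains28, Finset.sum_image (injOn_union hdisj), ← decoupling_19 σ₀ Φ s]
  refine Finset.sum_congr rfl fun σ hσ => ?_
  rw [union_sdiff_eq_of_disjoint hdisj (Finset.mem_powerset.1 hσ)]

/-- **(2.8) p. 14, both equalities**: `∫dμ₀(X)G(…) = Σ_Z H(Z, Z₀)` with the named summand `H28`.
[cite: Balaban1988RG2Cluster, (2.8) p.14] -/
theorem display_28_H (Z₀' σ₀ : Finset ι) (hdisj : Disjoint Z₀' σ₀) (Φ : (ι → ℝ) → E) (s : ι → ℝ) :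
    Φ (corner σ₀ σ₀ s) = ∑ Z ∈ domains28 Z₀' σ₀, H28 Z₀' σ₀ Φ s Z :=
  display_28 Z₀' σ₀ hdisj Φ s

/-- **(2.8) p. 14 with the printed range of summation** — *"The sums are over Z such, that each connected component
of Z contains a component of Z′₀"*: GIVEN that every other term vanishes (the mechanism of (1.10) p. 4, *"the
derivatives with respect to s restricted to these components render the term equal to 0"*,
`B13MayerDecoupling.Dop_eq_zero_of_indep` — for the paper's `Φ` a consequence of the locality of the random-walk
expansions of Sect. 1 and p. 13, by reference, NOT decided here), the sum of `display_28` may be restricted to the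
admissible domains (`Adm`, abstract; the tree's carriers are `B13Factor210Literal.AdmLit` / `B13Factor210.admMeets`).
[cite: Balaban1988RG2Cluster, (2.8) p.14] -/
theorem display_28_restricted (Adm : Finset ι → Prop) [DecidablePred Adm] (Z₀' σ₀ : Finset ι)
    (hdisj : Disjoint Z₀' σ₀) (Φ : (ι → ℝ) → E) (s : ι → ℝ)
    (h0 : ∀ Z ∈ domains28 Z₀' σ₀, ¬ Adm Z → H28 Z₀' σ₀ Φ s Z = 0) :
    Φ (corner σ₀ σ₀ s) = ∑ Z ∈ (domains28 Z₀' σ₀).filter Adm, H28 Z₀' σ₀ Φ s Z := by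
  rw [display_28_H Z₀' σ₀ hdisj Φ s, Finset.sum_filter_of_ne]
  intro Z hZ hne
  by_contra hA
  exact hne (h0 Z hZ hA)

end Difference

section Integral

variable {E : Type*} [NormedAddCommGroup E] [NormedSpace ℝ E] [CompleteSpace E]

/-- **(2.8) p. 14 with the printed integrals** `Π_{Δ⊂Z∖Z′₀} ∫₀¹ ds(Δ) ∂/∂s(Δ)` (`B13MayerDecoupling.Top`, products in
any order): for a function `Φ` of the parameters with continuous mixed partials along the parameter axes to all
orders (`B13MayerDecoupling.HasLinePartials Fam`, `Fam [] = Φ` — the paper's `Φ` is analytic in `s`, p. 5/p. 15),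
`Φ|_{s(σ₀)=1} = Σ_{Z} (Π_{Δ∈Z∖Z′₀} ∫₀¹ ds(Δ) ∂/∂s(Δ)) Φ |_{s(σ₀∖(Z∖Z′₀))=0}` over the domains `Z = Z′₀ ∪ σ`, `σ ⊆ σ₀`
— the instance of `B13MayerDecoupling.decoupling_19_integral`. [cite: Balaban1988RG2Cluster, (2.8) p.14] -/
theorem display_28_integral {Fam : List ι → (ι → ℝ) → E} (h : HasLinePartials Fam) (Z₀' σ₀ : Finset ι)
    (hdisj : Disjoint Z₀' σ₀) (s : ι → ℝ) :
    Fam [] (corner σ₀ σ₀ s) = ∑ Z ∈ domains28 Z₀' σ₀, Top (Z \ Z₀').toList Fam (corner σ₀ ∅ s) := by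
  rw [domains28, Finset.sum_image (injOn_union hdisj), ← decoupling_19_integral h σ₀ s]
  refine Finset.sum_congr rfl fun σ hσ => ?_
  rw [union_sdiff_eq_of_disjoint hdisj (Finset.mem_powerset.1 hσ)]

/-- The two forms of the summand agree for regular `Φ`: `(Π_{Δ∈Z∖Z′₀}∫₀¹ds(Δ)∂/∂s(Δ)) Φ|_{…=0} = H28 … Z`
(`B13MayerDecoupling.Top_eq_Dop`). [cite: Balaban1988RG2Cluster, (2.8) p.14] -/
theorem Top_eq_H28 {Fam : List ι → (ι → ℝ) → E} (h : HasLinePartials Fam) (Z₀' σ₀ : Finset ι) (s : ι → ℝ)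
    (Z : Finset ι) : Top (Z \ Z₀').toList Fam (corner σ₀ ∅ s) = H28 Z₀' σ₀ (Fam []) s Z := by
  rw [H28, Top_eq_Dop h (Z \ Z₀').toList (Finset.nodup_toList _), Finset.toList_toFinset]

end Integral

end Display28

end Literature.MathematicalPhysics.QuantumFieldTheory.Balaban1983to89.B13Sect2Statements
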